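import Literature.AlgebraicGeometry.Hu2025.Proofs.S07GammaSchemes.GammaQuadDef71Bridge
import Literature.AlgebraicGeometry.Hu2025.Proofs.S03Pluecker.GammaQuadCellDomain
import HarnessLib

/-!
# Hu 2025 — «cell integral, Z_Γ not» in row 109's vocabulary: the open matroid cell inside the typed Γ-scheme
# `Def7_1 (𝓕_m) Γ_quad` is integral (joint J1 / GAP-LEDGER-HU row HU-R01 — kernel support, OURS)

**HONEST FRAMING (D-0012/D-0089).** [Hu2025] is an unrefereed preprint under adjudication; nothing of it is asserted. This file transports
`QuadCell.isDomain_awayGammaChart_quad` (row-101 chart ring) to row 109's carrier `GammaSchemeRing (𝓕_m) Γ_quad` along the identification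
`gammaWpIdeal_quad_eq`. AI proof is weaker than expert review.
-/

noncomputable section

namespace Literature.AlgebraicGeometry.Hu2025.Statements.S07GammaSchemes

open MvPolynomial S03Pluecker

/-- **The product of the non-`Γ` chart coordinates** in row 109's Γ-scheme ring `GammaSchemeRing (𝓕_m) Γ_quad` (`n = 9`). OURS.
[cite: Hu2025, Def. 7.1 (Z_Γ) p.128 / Prop. 9.1 «p_u ≠ 0, ∀ x_u ∈ Δ_d» p.160; joint J1 = GAP-LEDGER-HU row HU-R01 (unrefereed preprint arXiv:2507.21400v1 under adjudication, D-0012/D-0089 — kernel support on OUR typed carriers of rows 101/109/110; nothing of the source asserted)] -/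
def quadCellDen (𝔽 : Type) [Field 𝔽] : GammaSchemeRing (S03Pluecker.primaryFamily 9 𝔽) quadGammaVar :=
  Ideal.Quotient.mk _ (QuadCell.hprod 𝔽)

/-- The ring isomorphism `GammaSchemeRing (𝓕_m) Γ_quad ≃ Rq` (same polynomial ring, equal ideals).
[cite: Hu2025, Def. 7.1 (Z_Γ) p.128; joint J1 = GAP-LEDGER-HU row HU-R01 (unrefereed preprint arXiv:2507.21400v1 under adjudication, D-0012/D-0089 — kernel support on OUR typed carriers of rows 101/109/110; nothing of the source asserted)] -/
def gammaSchemeRingQuadEquiv (𝔽 : Type) [Field 𝔽] :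
    GammaSchemeRing (S03Pluecker.primaryFamily 9 𝔽) quadGammaVar ≃+* QuadCell.Rq 𝔽 :=
  Ideal.quotEquivOfEq (gammaWpIdeal_quad_eq 𝔽)

/-- The isomorphism sends `quadCellDen` to `hq`.
[cite: Hu2025, Def. 7.1 (Z_Γ) p.128; joint J1 = GAP-LEDGER-HU row HU-R01 (unrefereed preprint arXiv:2507.21400v1 under adjudication, D-0012/D-0089 — kernel support on OUR typed carriers of rows 101/109/110; nothing of the source asserted)] -/
theorem gammaSchemeRingQuadEquiv_den (𝔽 : Type) [Field 𝔽] :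
    gammaSchemeRingQuadEquiv 𝔽 (quadCellDen 𝔽) = QuadCell.hq 𝔽 := by
  rw [quadCellDen, gammaSchemeRingQuadEquiv, Ideal.quotEquivOfEq_mk]
  rfl

/-- **The open matroid cell of the complete quadrilateral inside row 109's Γ-scheme is INTEGRAL**: the localisation of
`GammaSchemeRing (𝓕_m) Γ_quad` at the product of the non-`Γ` chart coordinates is a domain (`𝔽` of characteristic `0`), although
`GammaSchemeRing (𝓕_m) Γ_quad` itself is not (`not_isDomain_Def7_1_quad`, `not_ZGammaIntegral_quad`).
[cite: Hu2025, Def. 7.1 (Z_Γ) p.128 / Prop. 9.1 (Gr_d) p.160 / [Hu22] p.131 l.40–41 (the J1 inference); joint J1 = GAP-LEDGER-HU row HU-R01 (unrefereed preprint arXiv:2507.21400v1 under adjudication, D-0012/D-0089 — kernel support on OUR typed carriers of rows 101/109/110; nothing of the source asserted)] -/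
theorem isDomain_away_quadCellDen (𝔽 : Type) [Field 𝔽] [CharZero 𝔽] :
    IsDomain (Localization.Away (quadCellDen 𝔽)) := by
  haveI : IsDomain (QuadCell.Rh 𝔽) := QuadCell.isDomain_awayGammaChart_quad 𝔽
  have H : (Submonoid.powers (quadCellDen 𝔽)).map (gammaSchemeRingQuadEquiv 𝔽).toMonoidHom =
      Submonoid.powers (QuadCell.hq 𝔽) := by
    rw [Submonoid.map_powers]
    exact congrArg Submonoid.powers (gammaSchemeRingQuadEquiv_den 𝔽)
  let e : Localization.Away (quadCellDen 𝔽) ≃+* QuadCell.Rh 𝔽 :=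
    IsLocalization.ringEquivOfRingEquiv (Localization.Away (quadCellDen 𝔽)) (QuadCell.Rh 𝔽)
      (gammaSchemeRingQuadEquiv 𝔽) H
  exact e.toMulEquiv.isDomain

end Literature.AlgebraicGeometry.Hu2025.Statements.S07GammaSchemes

end
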